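import Summits.CriticalPhenomena.PercolationContinuityZ3.Theorems.PercNearOneGluingNoHeavyLowerTailSahiCombDomination
import Summits.CriticalPhenomena.PercolationContinuityZ3.Theorems.PercNearOneGluingNoHeavyLowerTailSahiCombStrata

/-!
# `NoHeavyLowerTail` (crux stmt-CriticalPhenomena-4575), the comb hierarchy at EVERY order: INTERSECTION-PRESERVING ENLARGEMENT DECREASES
# Sahi's `E_n` — the domination identity for all `n`, from the defect expansion

Support file (cell `prim-l12`, seat P3, gen 2; `--supports stmt-CriticalPhenomena-4575`).  No `sorry`, no named facts, standard axioms.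

**The identity** (`sahiE_cons_domination`; any weight, events `A ⊆ A'` at the head and `V_0,…,V_{m}`): subtracting the DEFECT EXPANSIONS
(`SahiDefectExpansion.sahiE_cons_eq_defect_expansion`, seat P5) of `E_{m+2}(1_A, 1_V)` and `E_{m+2}(1_{A'}, 1_V)`, the defects
`1 − 1_A` and `1 − 1_{A'}` differ by `1_{A'} − 1_A = 1_{A'∖A} ≥ 0`, so

  `E_{m+2}(1_A, 1_V) = E_{m+2}(1_{A'}, 1_V) + (μA' − μA)·E_{m+1}(1_V)`
  `                    + Σ_{∅ ≠ T ⊊ univ} |T|!·μ((A'∖A) ∩ ⋂_{i∈T} V_i)·E_{|Tᶜ|}(1_V|Tᶜ) − (m+1)!·μ((A'∖A) ∩ ⋂_i V_i)`.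

If ONE of the `V_i` does not meet `A' ∖ A` — i.e. `A' ∩ V_{i₀} = A ∩ V_{i₀}`, INTERSECTION-PRESERVING ENLARGEMENT — the last term and every
`T ∋ i₀` term vanish, and what is left is a nonnegative combination of meet moments times LOWER-ORDER Sahi functionals of sub-families.
Orders `3` and `4` written out are `…SahiCombDomination.sahiE_three_domination` and `…SahiCombDominationFour.sahiE_four_domination`.
Consequences (`U_j` increasing):
* **`combPos_sahiE_cons_of_enlarge`** — COMB LEVEL, all orders: GIVEN `MasterFamilyCombPos j` for all `j ≤ m+1` (the lower rows of the comb
  hierarchy; theorems for `m + 1 ≤ 2`), comb positivity of `E_{m+2}(1_{A'}, 1_V)` implies that of `E_{m+2}(1_A, 1_V)`.  So at every order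
  the extremal configurations of (M⁺) at a fixed intersection `A ∩ V_{i₀}` are the closed pairs, and (M⁺-(m+2)) descends along
  intersection-preserving enlargements; unconditional at order `3` (re-deriving `…SahiCombDomination`).
* **`sahiE_cons_ge_of_enlarge`** — MEASURE LEVEL, all orders: GIVEN `MasterFamilyNonneg j` for `j ≤ m+1` (Sahi's `C_j` on product measures
  for the lower orders), `E_{m+2}(μ_p; 1_A, 1_V) ≥ E_{m+2}(μ_p; 1_{A'}, 1_V)`.
Exact numerical evidence preceded the proof (orders 3, 4, 5; HOME code/gen2/domk.py, domformula.py: the closed formula above, 0 failures).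
-/

noncomputable section

open scoped Classical

namespace Summit.CriticalPhenomena.PercolationContinuityZ3.Theorems

namespace SahiCombDomination

open Finset Function
open scoped Nat
open Literature.Combinatorics.Sahi2008
open Literature.Probability.Percolation.DecisionTree (ind ind_of_mem ind_of_not_mem ind_nonneg)
open SahiComb

variable {ι : Type} [Fintype ι]

/-- Defects of nested events differ by the indicator of the difference, which is nonnegative. [folklore] -/
theorem ex_defect_sub_defect (μ : Set ι → ℝ) {A A' : Set (Set ι)} (P : Set ι → ℝ) :
    ex μ ((1 - ind A) * P) - ex μ ((1 - ind A') * P) = ex μ ((ind A' - ind A) * P) := by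
  simp only [ex_def, ← Finset.sum_sub_distrib]
  exact Finset.sum_congr rfl fun ω _ => by simp only [Pi.mul_apply, Pi.sub_apply, Pi.one_apply]; ring

/-- **The all-orders domination identity** (any weight): see the module docstring. [this work] -/
theorem sahiE_cons_domination (μ : Set ι → ℝ) (m : ℕ) (A A' : Set (Set ι)) (V : Fin (m + 1) → Set (Set ι)) :
    sahiE μ (m + 2) (Fin.cons (ind A) (fun j => ind (V j)) : Fin (m + 2) → Set ι → ℝ)
      = sahiE μ (m + 2) (Fin.cons (ind A') (fun j => ind (V j)) : Fin (m + 2) → Set ι → ℝ)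
        + (ex μ (ind A') - ex μ (ind A)) * sahiE μ (m + 1) (fun j => ind (V j))
        + ∑ T : Finset (Fin (m + 1)) with (T.Nonempty ∧ T ≠ univ),
            ((T.card)! : ℝ) * (ex μ ((ind A' - ind A) * ∏ i ∈ T, ind (V i))
              * sahiE μ Tᶜ.card (fun j => ind (V (Tᶜ.orderEmbOfFin rfl j))))
        - ((m + 1)! : ℝ) * ex μ ((ind A' - ind A) * ∏ i, ind (V i)) := by
  have hA := SahiDefectExpansion.sahiE_cons_eq_defect_expansion μ m (ind A) (fun j => ind (V j))
  have hA' := SahiDefectExpansion.sahiE_cons_eq_defect_expansion μ m (ind A') (fun j => ind (V j))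
  have hS : (∑ T : Finset (Fin (m + 1)) with (T.Nonempty ∧ T ≠ univ),
      ((T.card)! : ℝ) * (ex μ ((1 - ind A) * ∏ i ∈ T, ind (V i)) * sahiE μ Tᶜ.card (fun j => ind (V (Tᶜ.orderEmbOfFin rfl j)))))
      - (∑ T : Finset (Fin (m + 1)) with (T.Nonempty ∧ T ≠ univ),
      ((T.card)! : ℝ) * (ex μ ((1 - ind A') * ∏ i ∈ T, ind (V i)) * sahiE μ Tᶜ.card (fun j => ind (V (Tᶜ.orderEmbOfFin rfl j)))))
      = ∑ T : Finset (Fin (m + 1)) with (T.Nonempty ∧ T ≠ univ),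
      ((T.card)! : ℝ) * (ex μ ((ind A' - ind A) * ∏ i ∈ T, ind (V i)) * sahiE μ Tᶜ.card (fun j => ind (V (Tᶜ.orderEmbOfFin rfl j)))) := by
    rw [← Finset.sum_sub_distrib]
    refine Finset.sum_congr rfl fun T _ => ?_
    rw [← ex_defect_sub_defect μ (∏ i ∈ T, ind (V i))]
    ring
  have he := ex_defect_sub_defect μ (A := A) (A' := A') (∏ i, ind (V i))
  rw [hA, hA']
  linear_combination hS - ((m + 1)! : ℝ) * he

omit [Fintype ι] in
/-- The enlargement integrands are nonnegative for `A ⊆ A'`. [folklore] -/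
theorem ind_sub_mul_prod_nonneg {A A' : Set (Set ι)} (hAA' : A ⊆ A') {n : ℕ} (V : Fin n → Set (Set ι)) (T : Finset (Fin n))
    (ω : Set ι) : 0 ≤ ((ind A' - ind A) * ∏ i ∈ T, ind (V i)) ω := by
  simp only [Pi.mul_apply, Pi.sub_apply, Finset.prod_apply]
  refine mul_nonneg ?_ (Finset.prod_nonneg fun i _ => ind_nonneg _ _)
  by_cases h : ω ∈ A
  · rw [ind_of_mem h, ind_of_mem (hAA' h)]; norm_num
  · rw [ind_of_not_mem h]; simpa using ind_nonneg A' ω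

omit [Fintype ι] in
/-- Under intersection preservation at `i₀` (`A' ∩ V_{i₀} = A ∩ V_{i₀}`) the total enlargement moment vanishes. [this work] -/
theorem ind_sub_mul_prod_univ_eq_zero {A A' : Set (Set ι)} {n : ℕ} (V : Fin n → Set (Set ι)) (i₀ : Fin n)
    (hK : A' ∩ V i₀ = A ∩ V i₀) : (ind A' - ind A) * ∏ i, ind (V i) = 0 := by
  funext ω
  simp only [Pi.mul_apply, Pi.sub_apply, Finset.prod_apply, Pi.zero_apply]
  by_cases hω : ω ∈ V i₀
  · have hiff : ω ∈ A' ↔ ω ∈ A := by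
      constructor
      · intro h; exact (hK.le ⟨h, hω⟩).1
      · intro h; exact (hK.ge ⟨h, hω⟩).1
    by_cases hA : ω ∈ A
    · rw [ind_of_mem hA, ind_of_mem (hiff.2 hA)]; ring
    · rw [ind_of_not_mem hA, ind_of_not_mem fun h => hA (hiff.1 h)]; ring
  · have : (∏ i, ind (V i) ω) = 0 := Finset.prod_eq_zero (Finset.mem_univ i₀) (ind_of_not_mem hω)
    rw [this, mul_zero]

/-- **Comb level, all orders.**  GIVEN (M⁺-j) for all `j ≤ m+1`: for increasing `V_0,…,V_m`, events `A ⊆ A'` with `A' ∩ V_{i₀} = A ∩ V_{i₀}`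
for some `i₀`, comb positivity (multidegree `m+2`) of `E_{m+2}(1_{A'}, 1_V)` implies that of `E_{m+2}(1_A, 1_V)`. [this work] -/
theorem combPos_sahiE_cons_of_enlarge {m : ℕ} (hN : ∀ j, j ≤ m + 1 → MasterFamilyCombPos j) {A A' : Set (Set ι)}
    (V : Fin (m + 1) → Set (Set ι)) (hV : ∀ j, IsUpperSet (V j)) (hAA' : A ⊆ A') (i₀ : Fin (m + 1))
    (hK : A' ∩ V i₀ = A ∩ V i₀)
    (h : CombPos (fun _ : ι => m + 2)
      (fun p => sahiE (bernoulliWeight p) (m + 2) (Fin.cons (ind A') (fun j => ind (V j)) : Fin (m + 2) → Set ι → ℝ))) :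
    CombPos (fun _ : ι => m + 2)
      (fun p => sahiE (bernoulliWeight p) (m + 2) (Fin.cons (ind A) (fun j => ind (V j)) : Fin (m + 2) → Set ι → ℝ)) := by
  -- the pieces
  have hδ : CombPos (fun _ : ι => 1) (fun p => ex (bernoulliWeight p) (ind A') - ex (bernoulliWeight p) (ind A)) :=
    combPos_ex_sub_of_subset hAA'
  have hg : CombPos (fun _ : ι => m + 1) (fun p => sahiE (bernoulliWeight p) (m + 1) (fun j => ind (V j))) :=
    hN (m + 1) le_rfl ι V hV
  have hsub : ∀ T : Finset (Fin (m + 1)), CombPos (fun _ : ι => Tᶜ.card)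
      (fun p => sahiE (bernoulliWeight p) Tᶜ.card (fun j => ind (V (Tᶜ.orderEmbOfFin rfl j)))) := fun T =>
    hN Tᶜ.card (by simpa using Finset.card_le_univ Tᶜ) ι (fun j => V (Tᶜ.orderEmbOfFin rfl j)) fun j => hV _
  have hdefect : ∀ T : Finset (Fin (m + 1)), CombPos (fun _ : ι => 1)
      (fun p => ex (bernoulliWeight p) ((ind A' - ind A) * ∏ i ∈ T, ind (V i))) := fun T =>
    combPos_ex (ind_sub_mul_prod_nonneg hAA' V T)
  have hdeg : (fun _ : ι => (1 : ℕ)) + (fun _ : ι => m + 1) = fun _ : ι => m + 2 := by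
    funext e; simp only [Pi.add_apply]; omega
  have hterm : ∀ T ∈ (univ : Finset (Finset (Fin (m + 1)))).filter (fun T => T.Nonempty ∧ T ≠ univ),
      CombPos (fun _ : ι => m + 2) (fun p => ((T.card)! : ℝ) *
        (ex (bernoulliWeight p) ((ind A' - ind A) * ∏ i ∈ T, ind (V i)) *
          sahiE (bernoulliWeight p) Tᶜ.card (fun j => ind (V (Tᶜ.orderEmbOfFin rfl j))))) := by
    intro T _
    refine ((hdefect T).mul_of_le (hsub T) fun e => ?_).smul (Nat.cast_nonneg _)
    simp only [Pi.add_apply]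
    have := Finset.card_le_univ Tᶜ
    simp only [Fintype.card_fin] at this
    omega
  have htop : (ind A' - ind A) * ∏ i, ind (V i) = 0 := ind_sub_mul_prod_univ_eq_zero V i₀ hK
  have htot := ((h.add (hδ.mul_of_eq hg hdeg)).add (CombPos.sum _ hterm)).add (CombPos.zero (fun _ : ι => m + 2))
  refine htot.congr fun p => ?_
  rw [sahiE_cons_domination (bernoulliWeight p) m A A' V, htop]
  have h0 : ex (bernoulliWeight p) (0 : Set ι → ℝ) = 0 := by simp [ex_def]
  rw [h0]
  ring

/-- **Measure level, all orders.**  GIVEN Sahi's `C_j` on product measures for `j ≤ m+1` (`MasterFamilyNonneg j`): for increasing `V`,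
`A ⊆ A'` with `A' ∩ V_{i₀} = A ∩ V_{i₀}`, `E_{m+2}(μ_p; 1_A, 1_V) ≥ E_{m+2}(μ_p; 1_{A'}, 1_V)` for every `p`. [this work] -/
theorem sahiE_cons_ge_of_enlarge {m : ℕ} (hN : ∀ j, j ≤ m + 1 → MasterFamilyNonneg j) (p : ι → unitInterval)
    {A A' : Set (Set ι)} (V : Fin (m + 1) → Set (Set ι)) (hV : ∀ j, IsUpperSet (V j)) (hAA' : A ⊆ A') (i₀ : Fin (m + 1))
    (hK : A' ∩ V i₀ = A ∩ V i₀) :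
    sahiE (bernoulliWeight p) (m + 2) (Fin.cons (ind A') (fun j => ind (V j)) : Fin (m + 2) → Set ι → ℝ)
      ≤ sahiE (bernoulliWeight p) (m + 2) (Fin.cons (ind A) (fun j => ind (V j)) : Fin (m + 2) → Set ι → ℝ) := by
  rw [sahiE_cons_domination (bernoulliWeight p) m A A' V, ind_sub_mul_prod_univ_eq_zero V i₀ hK]
  have h0 : ex (bernoulliWeight p) (0 : Set ι → ℝ) = 0 := by simp [ex_def]
  rw [h0, mul_zero, sub_zero]
  have hδ : 0 ≤ ex (bernoulliWeight p) (ind A') - ex (bernoulliWeight p) (ind A) := (combPos_ex_sub_of_subset hAA').nonneg p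
  have hg : 0 ≤ sahiE (bernoulliWeight p) (m + 1) (fun j => ind (V j)) := hN (m + 1) le_rfl ι p V hV
  have hS : 0 ≤ ∑ T : Finset (Fin (m + 1)) with (T.Nonempty ∧ T ≠ univ),
      ((T.card)! : ℝ) * (ex (bernoulliWeight p) ((ind A' - ind A) * ∏ i ∈ T, ind (V i))
        * sahiE (bernoulliWeight p) Tᶜ.card (fun j => ind (V (Tᶜ.orderEmbOfFin rfl j)))) := by
    refine Finset.sum_nonneg fun T _ => mul_nonneg (Nat.cast_nonneg _) (mul_nonneg ?_ ?_)
    · exact (combPos_ex (ind_sub_mul_prod_nonneg hAA' V T)).nonneg p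
    · exact hN Tᶜ.card (by simpa using Finset.card_le_univ Tᶜ) ι p (fun j => V (Tᶜ.orderEmbOfFin rfl j)) fun j => hV _
  nlinarith [mul_nonneg hδ hg]

/-- **Order 3, unconditionally** (re-deriving `…SahiCombDomination` from the all-orders identity; (M⁺-1), (M⁺-2) are theorems). [this work] -/
theorem combPos_sahiE_three_cons_of_enlarge {A A' : Set (Set ι)} (V : Fin 2 → Set (Set ι)) (hV : ∀ j, IsUpperSet (V j))
    (hAA' : A ⊆ A') (i₀ : Fin 2) (hK : A' ∩ V i₀ = A ∩ V i₀)
    (h : CombPos (fun _ : ι => 3)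
      (fun p => sahiE (bernoulliWeight p) 3 (Fin.cons (ind A') (fun j => ind (V j)) : Fin 3 → Set ι → ℝ))) :
    CombPos (fun _ : ι => 3)
      (fun p => sahiE (bernoulliWeight p) 3 (Fin.cons (ind A) (fun j => ind (V j)) : Fin 3 → Set ι → ℝ)) :=
  combPos_sahiE_cons_of_enlarge (m := 1) (fun _ hj => masterFamilyCombPos_of_le_two hj) V hV hAA' i₀ hK h

end SahiCombDomination

end Summit.CriticalPhenomena.PercolationContinuityZ3.Theorems
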